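import Literature.Analysis.FluidPDE.AncientFarFieldBound
import Literature.Analysis.FluidPDE.SuitableWeakInBallTools
import Literature.Analysis.FluidPDE.ClassicalSuitable
import Literature.Analysis.FluidPDE.SereginSverakPressureProofs
import Literature.Analysis.FluidPDE.PressureDecayEstimateProofs
import Literature.Analysis.FluidPDE.Seregin2020ScaledEnergyBounds
import HarnessLib

/-!
# Concentration at a singular point of a classical solution (Wang–Zhang 2017, §4 Step 1, set-up)

Analysis/FluidPDE proofs-only file (theorems only: no definition, no named fact; nothing accepted
is restated or changed). The blow-up argument of W. Wang, Z. Zhang, *Blow-up of critical norms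
for the 3-D Navier–Stokes equations*, Sci. China Math. 60 (2017) = arXiv:1510.02589, §4, starts
from "Assume that the solution is singular at `t = T` … we may assume `(0, 0)` is a singular
point" and uses the `ε`-regularity criterion to extract concentration at all small scales. This
file supplies, for a pair `(u, p)` that is a suitable weak solution on an open set containing the
closure of a small cylinder, the one-scale `ε`-regularity bound (`ae_norm_le_of_small_of_suitableOn`,
the tree's RRS 2016 Thm. 15.3 zoomed to scale `θ`); for the classical Leray–Hopf solutions of the
continuation criterion, whose apex `(T, x₀)` lies on the top boundary of the slab, the passage
from smallness of `C + D` at the apex `(T, x₀)` to boundedness on `Q_{ρ/2}(T, x₀)` through apices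
`(T', x₀)`, `T' ↑ T` (`eLpNorm_top_lt_top_of_cknC_add_cknD_lt`); and the concentration of `C` at
all small scales from concentration of `C + D` and a bound on `D`, by the pressure decay estimate
(`le_cknC_of_forall_le_cknC_add_cknD`; Seregin–Šverák 2002, Lemma 3.5 (as13)).

## References

* W. Wang, Z. Zhang, Sci. China Math. 60 (2017) = arXiv:1510.02589, §4 Step 1. [WangZhang2016]
* J. C. Robinson, J. L. Rodrigo, W. Sadowski, *The three-dimensional Navier–Stokes equations*
  (2016), Thm. 15.3. [RobinsonRodrigoSadowski2016]
* G. Seregin, V. Šverák, Arch. Ration. Mech. Anal. 163 (2002), Lemma 3.5. [SereginSverak2009]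
-/

noncomputable section

open MeasureTheory Set Function Filter Topology TopologicalSpace Metric
open scoped NNReal ENNReal RealInnerProductSpace

namespace Literature.Analysis.FluidPDE

/-! ### One-scale `ε`-regularity for a suitable weak solution on a neighbourhood of a closed cylinder -/

section NearPoint

variable {u : ℝ → EuclideanSpace ℝ (Fin 3) → EuclideanSpace ℝ (Fin 3)}
  {p : ℝ → EuclideanSpace ℝ (Fin 3) → ℝ}

/-- **One-scale `ε`-regularity at scale `θ`** (RRS 2016, Thm. 15.3, zoomed): if `(u, p)` is a
suitable weak solution on an open set `Q'` containing the closure of `Q_θ(z₂)` and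
`C(θ; z₂) + D(θ; z₂) ≤ ε₀ ≤ ε₁`, then `|u| ≤ c_M ε₀^{1/3}/θ` a.e. on `Q_{θ/2}(z₂)`.
[cite: RobinsonRodrigoSadowski2016, Thm. 15.3] -/
theorem ae_norm_le_of_small_of_suitableOn {Q' : Opens (ℝ × EuclideanSpace ℝ (Fin 3))}
    (hsol : IsSuitableWeakSolutionOn Q' 1 0 u p) {ε₁ cM : ℝ}
    (H : ∀ (z₀ : ℝ × EuclideanSpace ℝ (Fin 3)) (u : ℝ → EuclideanSpace ℝ (Fin 3) → EuclideanSpace ℝ (Fin 3))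
      (p : ℝ → EuclideanSpace ℝ (Fin 3) → ℝ)
      (G : ℝ → EuclideanSpace ℝ (Fin 3) → EuclideanSpace ℝ (Fin 3) →L[ℝ] EuclideanSpace ℝ (Fin 3)),
      RRS2016.IsSuitablePair (parabolicCylinderOpens 1 z₀) 1 0 u p G →
      ∀ ε₀ : ℝ, 0 < ε₀ → ε₀ ≤ ε₁ → RRS2016.Small ε₀ u p z₀ →
        ∀ᵐ w ∂(volume.restrict (parabolicCylinder (1 / 2) z₀)), ‖u w.1 w.2‖ ≤ cM * ε₀ ^ (1 / 3 : ℝ))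
    {θ : ℝ} (hθ : 0 < θ) {z₂ : ℝ × EuclideanSpace ℝ (Fin 3)}
    (hcl : closure (parabolicCylinder θ z₂) ⊆ (Q' : Set (ℝ × EuclideanSpace ℝ (Fin 3))))
    {ε₀ : ℝ} (hε₀ : 0 < ε₀) (hε₀₁ : ε₀ ≤ ε₁)
    (hsmall : cknC θ z₂ u + cknD θ z₂ p ≤ ENNReal.ofReal ε₀) :
    ∀ᵐ z ∂(volume.restrict (parabolicCylinder (θ / 2) z₂)),
      ‖u z.1 z.2‖ ≤ cM * ε₀ ^ (1 / 3 : ℝ) / θ := by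
  have hθ2 : 0 < θ ^ 2 := pow_pos hθ 2
  -- the zoom about `z₂` is a suitable weak solution on the preimage of `Q'`
  set Q'' : Opens (ℝ × EuclideanSpace ℝ (Fin 3)) := stPreimage (θ ^ 2) θ z₂.1 z₂.2 Q' with hQ''
  have hsol' : IsSuitableWeakSolutionOn Q'' 1 0 (θ • stPull (θ ^ 2) θ z₂.1 z₂.2 u)
      (θ ^ 2 • stPull (θ ^ 2) θ z₂.1 z₂.2 p) := by
    have h0 := hsol.stRescale hθ hθ (sq θ) z₂.1 z₂.2
    have hvisc : θ * 1 / θ = 1 := by field_simp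
    have hforce : ((θ ^ 2 * θ) • stPull (θ ^ 2) θ z₂.1 z₂.2
        (0 : ℝ → EuclideanSpace ℝ (Fin 3) → EuclideanSpace ℝ (Fin 3))) = 0 := by
      funext s y; simp [stPull]
    rw [hvisc, hforce] at h0
    exact h0
  -- the closure of `Q(1)` lies in the preimage
  have hcont : Continuous (stAffine (θ ^ 2) θ z₂.1 z₂.2 :
      ℝ × EuclideanSpace ℝ (Fin 3) → ℝ × EuclideanSpace ℝ (Fin 3)) :=
    (lipschitzWith_stAffine hθ2.le hθ.le z₂.1 z₂.2).continuous
  have himg : stAffine (θ ^ 2) θ z₂.1 z₂.2 '' parabolicCylinder 1 (0 : ℝ × EuclideanSpace ℝ (Fin 3)) ⊆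
      parabolicCylinder θ z₂ := by
    rintro _ ⟨w, hw, rfl⟩
    refine zoom_mem_parabolicCylinder hθ z₂ ?_
    rwa [div_self hθ.ne']
  have hcl' : closure (parabolicCylinder 1 (0 : ℝ × EuclideanSpace ℝ (Fin 3))) ⊆
      (Q'' : Set (ℝ × EuclideanSpace ℝ (Fin 3))) := by
    intro z hz
    show stAffine (θ ^ 2) θ z₂.1 z₂.2 z ∈ (Q' : Set (ℝ × EuclideanSpace ℝ (Fin 3)))
    refine hcl ?_
    have h1 := image_closure_subset_closure_image hcont
      (s := parabolicCylinder 1 (0 : ℝ × EuclideanSpace ℝ (Fin 3))) ⟨z, hz, rfl⟩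
    exact closure_mono himg h1
  -- the RRS suitable pair on `Q(1)` (zero force)
  have hfi : LocallyIntegrableOn (uncurry (0 : ℝ → EuclideanSpace ℝ (Fin 3) → EuclideanSpace ℝ (Fin 3)))
      (Q'' : Set (ℝ × EuclideanSpace ℝ (Fin 3))) volume :=
    (locallyIntegrable_zero).locallyIntegrableOn _
  have hdivf : ∀ φ : ℝ → EuclideanSpace ℝ (Fin 3) → ℝ, IsSpaceTimeTestOn Q'' φ →
      ∫ t, ∫ x, ⟪(0 : ℝ → EuclideanSpace ℝ (Fin 3) → EuclideanSpace ℝ (Fin 3)) t x, gradient (φ t) x⟫ = 0 := by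
    intro φ _; simp
  obtain ⟨G, hpair⟩ := hsol'.rrs_isSuitablePair hfi hdivf hcl'
  -- smallness on `Q(1)`
  have hSmall : RRS2016.Small ε₀ (θ • stPull (θ ^ 2) θ z₂.1 z₂.2 u)
      (θ ^ 2 • stPull (θ ^ 2) θ z₂.1 z₂.2 p) (0 : ℝ × EuclideanSpace ℝ (Fin 3)) := by
    have hmeas : AEMeasurable (fun q : ℝ × EuclideanSpace ℝ (Fin 3) =>
        ‖(θ • stPull (θ ^ 2) θ z₂.1 z₂.2 u) q.1 q.2‖ₑ ^ (3 : ℕ))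
        (volume.restrict (parabolicCylinder 1 (0 : ℝ × EuclideanSpace ℝ (Fin 3)))) := by
      have h1 : AEStronglyMeasurable (uncurry (θ • stPull (θ ^ 2) θ z₂.1 z₂.2 u))
          (volume.restrict (parabolicCylinder 1 (0 : ℝ × EuclideanSpace ℝ (Fin 3)))) :=
        (hsol'.distributional.1.aestronglyMeasurable).mono_measure
          (Measure.restrict_mono (subset_closure.trans hcl') le_rfl)
      exact h1.enorm.pow_const 3
    show ∫⁻ q in parabolicCylinder 1 (0 : ℝ × EuclideanSpace ℝ (Fin 3)),
        (‖(θ • stPull (θ ^ 2) θ z₂.1 z₂.2 u) q.1 q.2‖ₑ ^ (3 : ℕ) +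
          ‖(θ ^ 2 • stPull (θ ^ 2) θ z₂.1 z₂.2 p) q.1 q.2‖ₑ ^ (3 / 2 : ℝ)) ≤ ENNReal.ofReal ε₀
    rw [lintegral_add_left' hmeas, lintegral_cube_zoom hθ z₂ u, lintegral_pressure_zoom hθ z₂ p]
    exact hsmall
  have hbd := H 0 _ _ G hpair ε₀ hε₀ hε₀₁ hSmall
  exact ae_norm_le_of_ae_norm_le_zoom hθ z₂ hbd

end NearPoint

/-! ### Concentration of `C` from concentration of `C + D` and a bound on `D` -/

section PressureDecay

variable {u : ℝ → EuclideanSpace ℝ (Fin 3) → EuclideanSpace ℝ (Fin 3)}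
  {p : ℝ → EuclideanSpace ℝ (Fin 3) → ℝ}

/-- **`C` concentrates at all small scales if `C + D` does and `D` is bounded** (Wang–Zhang 2017,
§4 Step 1: "there exists a positive constant `η` independent of `k` such that `∫_{Q_1}|u^k|³ > η`";
via the pressure decay estimate, Seregin–Šverák 2002, Lemma 3.5: if `C(ρ₁) < η` at one scale then
`(C + D)(θρ₁) < ε₀` at the smaller scale `θρ₁`). [cite: WangZhang2016, §4 Step 1] [cite: SereginSverak2009, Lemma 3.5 (as13)] -/
theorem exists_forall_le_cknC_of_forall_le_cknC_add_cknD
    {Q : Opens (ℝ × EuclideanSpace ℝ (Fin 3))} (hsol : IsDistributionalNSSolutionOn Q 1 0 u p)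
    {z : ℝ × EuclideanSpace ℝ (Fin 3)} {R₁ : ℝ}
    (hQ : parabolicCylinder R₁ z ⊆ (Q : Set (ℝ × EuclideanSpace ℝ (Fin 3))))
    {ε₀ : ℝ} (hε₀ : 0 < ε₀) {K : ℝ≥0}
    (hconc : ∀ ρ ∈ Ioc 0 R₁, ENNReal.ofReal ε₀ ≤ cknC ρ z u + cknD ρ z p)
    (hD : ∀ ρ ∈ Ioc 0 R₁, cknD ρ z p ≤ K) :
    ∃ η : ℝ, 0 < η ∧ ∀ ρ ∈ Ioc 0 R₁, ENNReal.ofReal η ≤ cknC ρ z u := by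
  obtain ⟨c, hc⟩ := seregin_sverak_pressure_decay_holds
  have hc0 : (0 : ℝ) ≤ c := c.coe_nonneg
  have hK0 : (0 : ℝ) ≤ K := K.coe_nonneg
  -- the ratio and the level
  set θ : ℝ := min (1 / 2) (ε₀ / (4 * ((c : ℝ) + 1) * ((K : ℝ) + 1))) with hθdef
  have hθpos : 0 < θ := by rw [hθdef]; positivity
  have hθhalf : θ ≤ 1 / 2 := min_le_left _ _
  have hθ1 : θ ≤ 1 := hθhalf.trans (by norm_num)
  have hθε : θ * (4 * ((c : ℝ) + 1) * ((K : ℝ) + 1)) ≤ ε₀ := by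
    have h := min_le_right (1 / 2 : ℝ) (ε₀ / (4 * ((c : ℝ) + 1) * ((K : ℝ) + 1)))
    rw [← hθdef] at h
    rwa [le_div_iff₀ (by positivity)] at h
  set η : ℝ := θ ^ 2 * ε₀ / (4 * ((c : ℝ) + 1)) with hηdef
  have hηpos : 0 < η := by rw [hηdef]; positivity
  refine ⟨η, hηpos, fun ρ₁ hρ₁ => ?_⟩
  by_contra hlt
  rw [not_le] at hlt
  have hρ₁0 : ρ₁ ≠ 0 := hρ₁.1.ne'
  -- at the scale `θ ρ₁`
  have hρθ : θ * ρ₁ ∈ Ioc 0 R₁ :=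
    ⟨mul_pos hθpos hρ₁.1, (mul_le_of_le_one_left hρ₁.1.le hθ1).trans hρ₁.2⟩
  have hsub : parabolicCylinder ρ₁ z ⊆ (Q : Set (ℝ × EuclideanSpace ℝ (Fin 3))) :=
    (parabolicCylinder_mono hρ₁.1.le hρ₁.2 z).trans hQ
  -- `C(θρ₁) ≤ θ⁻² C(ρ₁) < θ⁻² η`
  have hC : cknC (θ * ρ₁) z u ≤ ENNReal.ofReal (θ⁻¹ ^ 2) * cknC ρ₁ z u := by
    have h := Seregin2020.cknC_le_mul_of_subset hρ₁.1 (mul_pos hθpos hρ₁.1)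
      (parabolicCylinder_mono (mul_pos hθpos hρ₁.1).le (mul_le_of_le_one_left hρ₁.1.le hθ1) z) u
    rwa [show ρ₁ / (θ * ρ₁) = θ⁻¹ by field_simp, ← ENNReal.ofReal_pow (by positivity)] at h
  -- `D(θρ₁) ≤ c (θ D(ρ₁) + θ⁻² C(ρ₁))`
  have hDθ : cknD (θ * ρ₁) z p ≤ c * (ENNReal.ofReal θ * cknD ρ₁ z p +
      ENNReal.ofReal (θ⁻¹ ^ 2) * cknC ρ₁ z u) := by
    have h := hc Q u p hsol z ρ₁ (θ * ρ₁) (mul_pos hθpos hρ₁.1)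
      (mul_le_of_le_one_left hρ₁.1.le hθ1) hsub
    rwa [show θ * ρ₁ / ρ₁ = θ by field_simp, show (ρ₁ / (θ * ρ₁)) ^ 2 = θ⁻¹ ^ 2 by
      field_simp] at h
  -- everything is finite: pass to real numbers
  have hCfin : cknC ρ₁ z u < ⊤ := hlt.trans ENNReal.ofReal_lt_top
  have hDfin : cknD ρ₁ z p < ⊤ := (hD ρ₁ hρ₁).trans_lt ENNReal.coe_lt_top
  set Cr : ℝ := (cknC ρ₁ z u).toReal with hCr
  set Dr : ℝ := (cknD ρ₁ z p).toReal with hDr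
  have eC : cknC ρ₁ z u = ENNReal.ofReal Cr := (ENNReal.ofReal_toReal hCfin.ne).symm
  have eD : cknD ρ₁ z p = ENNReal.ofReal Dr := (ENNReal.ofReal_toReal hDfin.ne).symm
  have ec : (c : ℝ≥0∞) = ENNReal.ofReal (c : ℝ) := (ENNReal.ofReal_coe_nnreal).symm
  have hCre : Cr < η := by
    rw [hCr, ← ENNReal.toReal_ofReal hηpos.le]
    exact (ENNReal.toReal_lt_toReal hCfin.ne ENNReal.ofReal_ne_top).2 hlt
  have hCnn : 0 ≤ Cr := ENNReal.toReal_nonneg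
  have hDnn : 0 ≤ Dr := ENNReal.toReal_nonneg
  have hDre : Dr ≤ K := by
    have := ENNReal.toReal_mono ENNReal.coe_ne_top (hD ρ₁ hρ₁)
    rwa [ENNReal.coe_toReal] at this
  -- the bound at scale `θρ₁`, in `ℝ≥0∞` with real coefficients
  have hsum : cknC (θ * ρ₁) z u + cknD (θ * ρ₁) z p ≤
      ENNReal.ofReal (θ⁻¹ ^ 2 * Cr + (c : ℝ) * (θ * Dr + θ⁻¹ ^ 2 * Cr)) := by
    refine (add_le_add hC hDθ).trans (le_of_eq ?_)
    rw [eC, eD, ec, ← ENNReal.ofReal_mul (by positivity), ← ENNReal.ofReal_mul hθpos.le,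
      ← ENNReal.ofReal_add (by positivity) (by positivity),
      ← ENNReal.ofReal_mul hc0, ← ENNReal.ofReal_add (by positivity) (by positivity)]
  -- the real number is `< ε₀`
  have hreal : θ⁻¹ ^ 2 * Cr + (c : ℝ) * (θ * Dr + θ⁻¹ ^ 2 * Cr) < ε₀ := by
    have hθ2 : 0 < θ ^ 2 := pow_pos hθpos 2
    have e1 : θ⁻¹ ^ 2 * η = ε₀ / (4 * ((c : ℝ) + 1)) := by
      rw [hηdef, inv_pow]; field_simp
    have h1 : θ⁻¹ ^ 2 * Cr < ε₀ / (4 * ((c : ℝ) + 1)) := by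
      rw [← e1]; exact mul_lt_mul_of_pos_left hCre (by positivity)
    have h2 : (c : ℝ) * (θ * Dr) ≤ ε₀ / 4 := by
      have h3 : (c : ℝ) * (θ * Dr) ≤ (c : ℝ) * (θ * K) := by gcongr
      refine h3.trans ?_
      have h4 : (c : ℝ) * (θ * K) ≤ θ * (((c : ℝ) + 1) * ((K : ℝ) + 1)) := by nlinarith
      have h5 : θ * (((c : ℝ) + 1) * ((K : ℝ) + 1)) ≤ ε₀ / 4 := by
        rw [le_div_iff₀ (by norm_num : (0 : ℝ) < 4)]; nlinarith
      linarith
    have h3 : (c : ℝ) * (θ⁻¹ ^ 2 * Cr) ≤ (c : ℝ) * (ε₀ / (4 * ((c : ℝ) + 1))) :=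
      mul_le_mul_of_nonneg_left h1.le hc0
    have h4 : ε₀ / (4 * ((c : ℝ) + 1)) + (c : ℝ) * (ε₀ / (4 * ((c : ℝ) + 1))) = ε₀ / 4 := by
      field_simp; ring
    calc θ⁻¹ ^ 2 * Cr + (c : ℝ) * (θ * Dr + θ⁻¹ ^ 2 * Cr)
        = θ⁻¹ ^ 2 * Cr + (c : ℝ) * (θ * Dr) + (c : ℝ) * (θ⁻¹ ^ 2 * Cr) := by ring
      _ < ε₀ / (4 * ((c : ℝ) + 1)) + ε₀ / 4 + (c : ℝ) * (ε₀ / (4 * ((c : ℝ) + 1))) := by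
          linarith
      _ = ε₀ / 4 + ε₀ / 4 := by linarith [h4]
      _ < ε₀ := by linarith
  have hcontra := (hconc _ hρθ).trans hsum
  exact absurd (ENNReal.ofReal_le_ofReal_iff (by positivity) |>.1 hcontra) (not_le.2 hreal)

end PressureDecay

/-! ### Albritton–Barker's class at the final-time apex of a classical Leray–Hopf solution -/

section Apex

variable {u : ℝ → EuclideanSpace ℝ (Fin 3) → EuclideanSpace ℝ (Fin 3)}
  {p : ℝ → EuclideanSpace ℝ (Fin 3) → ℝ} {T : ℝ}

/-- **The classical Leray–Hopf solution with its gauged pressure is a suitable weak solution in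
the parabolic ball `Q_ρ(T, x₀)` in the class of Albritton–Barker's Def. 2.1** (apex on the final
time): the local notion restricts from the slab; `u ∈ L^∞_t L²_x` by the energy bound; the
classical gradient is a weak gradient, square integrable on the cylinder by hypothesis (the bound
on `E`); the gauged pressure is in `L^{3/2}` of the slab. [folklore] -/
theorem isSuitableWeakSolutionInBall_apex_of_classical (hT : 0 < T)
    (hsol : IsClassicalNSSolutionOn (Ico 0 T) 1 0 u p) (hLH : IsLerayHopfOn T 1 0 (u 0) u)
    {x₀ : EuclideanSpace ℝ (Fin 3)} {ρ : ℝ} (hρT : ρ ^ 2 ≤ T)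
    (hE : ∫⁻ q in parabolicCylinder ρ (T, x₀),
      ENNReal.ofReal (frobeniusNormSq (fderiv ℝ (u q.1) q.2)) < ∞) :
    IsSuitableWeakSolutionInBall ρ (T, x₀) u
      (fun t x => p t x - (p t 0 - normalisedPressure (u t) 0)) := by
  set qg : ℝ → EuclideanSpace ℝ (Fin 3) → ℝ := fun t x => p t x - (p t 0 - normalisedPressure (u t) 0)
    with hqg
  set Q : Opens (ℝ × EuclideanSpace ℝ (Fin 3)) :=
    ⟨Ioo 0 T ×ˢ univ, isOpen_Ioo.prod isOpen_univ⟩ with hQdef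
  have hQ : (Q : Set (ℝ × EuclideanSpace ℝ (Fin 3))) ⊆ Ioo 0 T ×ˢ univ := Subset.rfl
  have hsw : IsSuitableWeakSolutionOn Q 1 0 u qg :=
    SereginSverak2002.isSuitableWeakSolutionOn_gauge_of_classical one_pos hT hsol hLH Q hQ
  have hIsub : Ioo (T - ρ ^ 2) T ⊆ Ioo 0 T := Ioo_subset_Ioo (by linarith) le_rfl
  have hcyl : parabolicCylinder ρ (T, x₀) ⊆ (Q : Set (ℝ × EuclideanSpace ℝ (Fin 3))) := by
    intro w hw
    rw [mem_parabolicCylinder] at hw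
    exact ⟨hIsub hw.1, mem_univ _⟩
  have hle : parabolicCylinderOpens ρ (T, x₀) ≤ Q := fun w hw => hcyl hw
  refine ⟨hsw.of_le hle, ?_, ⟨fun t x => fderiv ℝ (u t) x, ?_, hE⟩, ?_⟩
  · -- the energy class
    obtain ⟨C, hC⟩ := hLH.energy_bound
    refine ⟨C, ?_⟩
    have hC' := ae_restrict_of_ae_restrict_of_subset hIsub hC
    filter_upwards [hC'] with t ht
    exact (setLIntegral_le_lintegral _ _).trans ht
  · -- the classical gradient is a weak gradient on the cylinder
    have hsm : IsSmoothSpaceTimeOn (Ioo 0 T) u := hsol.smooth_velocity.mono Ioo_subset_Ico_self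
    have hG : HasWeakSpatialGradientOn Q u fun t x => fderiv ℝ (u t) x :=
      hasWeakSpatialGradientOn_of_contDiffOn isOpen_Ioo hQ (hsm.of_le (by exact_mod_cast le_top))
    exact hG.mono hle
  · -- the gauged pressure is in `L^{3/2}(Q_ρ(T, x₀))`
    have hpm : AEStronglyMeasurable (uncurry qg) (volume.restrict (parabolicCylinder ρ (T, x₀))) :=
      (hsw.distributional.2.2.1.aestronglyMeasurable).mono_measure (Measure.restrict_mono hcyl le_rfl)
    refine ⟨hpm, ?_⟩
    obtain ⟨h32, h32', h32r⟩ := threeHalves_facts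
    rw [eLpNorm_eq_lintegral_rpow_enorm_toReal (zero_lt_one.trans_le h32).ne' h32', h32r]
    refine ENNReal.rpow_lt_top_of_nonneg (by norm_num) (lt_of_le_of_lt (lintegral_mono_set hcyl) ?_).ne
    have h := SereginSverak2002.lintegral_slab_gauged_pressure_lt_top one_pos hT hsol hLH
    exact h

end Apex

/-! ### Boundedness below the final-time apex from smallness of `C + D` there -/

section ApexRegular

variable {u : ℝ → EuclideanSpace ℝ (Fin 3) → EuclideanSpace ℝ (Fin 3)}
  {p : ℝ → EuclideanSpace ℝ (Fin 3) → ℝ} {T : ℝ}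

set_option maxHeartbeats 1600000 in
/-- **Smallness of `C + D` at the final-time apex `(T, x₀)` implies boundedness on
`Q_{ρ/2}(T, x₀)`** for the classical Leray–Hopf solutions of the continuation criterion (the
`ε`-regularity criterion at a point of the top boundary; Wang–Zhang 2017, §4: "Assume that the
solution is singular at `t = T`"): the quantity `C + D` at the apices `(T', x₀)`, `T' ↑ T`, is
eventually below the threshold (continuity from above of the finite measure with density
`|u|³ + |q|^{3/2}` on the slab), the one-scale criterion bounds `u` on each `Q_{ρ/2}(T', x₀)` by
the same constant, and these cylinders cover `Q_{ρ/2}(T, x₀)`. [cite: WangZhang2016, §4 Step 1] [cite: RobinsonRodrigoSadowski2016, Thm. 15.3] -/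
theorem eLpNorm_top_lt_top_of_cknC_add_cknD_lt (hT : 0 < T)
    (hsol : IsClassicalNSSolutionOn (Ico 0 T) 1 0 u p) (hLH : IsLerayHopfOn T 1 0 (u 0) u)
    {ε₁ cM : ℝ} (hε₁ : 0 < ε₁)
    (H : ∀ (z₀ : ℝ × EuclideanSpace ℝ (Fin 3)) (u : ℝ → EuclideanSpace ℝ (Fin 3) → EuclideanSpace ℝ (Fin 3))
      (p : ℝ → EuclideanSpace ℝ (Fin 3) → ℝ)
      (G : ℝ → EuclideanSpace ℝ (Fin 3) → EuclideanSpace ℝ (Fin 3) →L[ℝ] EuclideanSpace ℝ (Fin 3)),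
      RRS2016.IsSuitablePair (parabolicCylinderOpens 1 z₀) 1 0 u p G →
      ∀ ε₀ : ℝ, 0 < ε₀ → ε₀ ≤ ε₁ → RRS2016.Small ε₀ u p z₀ →
        ∀ᵐ w ∂(volume.restrict (parabolicCylinder (1 / 2) z₀)), ‖u w.1 w.2‖ ≤ cM * ε₀ ^ (1 / 3 : ℝ))
    {x₀ : EuclideanSpace ℝ (Fin 3)} {ρ : ℝ} (hρ : 0 < ρ) (hρT : ρ ^ 2 < T)
    (hsmall : cknC ρ (T, x₀) u +
      cknD ρ (T, x₀) (fun t x => p t x - (p t 0 - normalisedPressure (u t) 0)) < ENNReal.ofReal ε₁) :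
    eLpNorm (uncurry u) ∞ (volume.restrict (parabolicCylinder (ρ / 2) (T, x₀))) < ∞ := by
  set qg : ℝ → EuclideanSpace ℝ (Fin 3) → ℝ := fun t x => p t x - (p t 0 - normalisedPressure (u t) 0)
    with hqg
  set Q : Opens (ℝ × EuclideanSpace ℝ (Fin 3)) :=
    ⟨Ioo 0 T ×ˢ univ, isOpen_Ioo.prod isOpen_univ⟩ with hQdef
  have hQ : (Q : Set (ℝ × EuclideanSpace ℝ (Fin 3))) ⊆ Ioo 0 T ×ˢ univ := Subset.rfl
  have hsw : IsSuitableWeakSolutionOn Q 1 0 u qg :=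
    SereginSverak2002.isSuitableWeakSolutionOn_gauge_of_classical one_pos hT hsol hLH Q hQ
  have hρ2 : 0 < ρ ^ 2 := pow_pos hρ 2
  -- ### the density and the shrinking boxes
  set g : ℝ × EuclideanSpace ℝ (Fin 3) → ℝ≥0∞ := fun q => ‖u q.1 q.2‖ₑ ^ (3 : ℕ) + ‖qg q.1 q.2‖ₑ ^ (3 / 2 : ℝ)
    with hgdef
  set ν : Measure (ℝ × EuclideanSpace ℝ (Fin 3)) := volume.withDensity g with hνdef
  have hνac : ν ≪ volume := withDensity_absolutelyContinuous _ _
  set Tn : ℕ → ℝ := fun n => T - (T - ρ ^ 2) / ((n : ℝ) + 2) with hTn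
  have hTn_lt : ∀ n, Tn n < T := fun n => by
    rw [hTn]; dsimp only
    have : 0 < (T - ρ ^ 2) / ((n : ℝ) + 2) := by apply div_pos <;> [linarith; positivity]
    linarith
  have hTn_ge : ∀ n, (T - ρ ^ 2) / 2 + ρ ^ 2 ≤ Tn n := fun n => by
    rw [hTn]; dsimp only
    have h1 : (T - ρ ^ 2) / ((n : ℝ) + 2) ≤ (T - ρ ^ 2) / 2 :=
      div_le_div_of_nonneg_left (by linarith) (by norm_num) (by
        have : (0 : ℝ) ≤ n := n.cast_nonneg
        linarith)
    linarith
  have hTn_pos : ∀ n, 0 < Tn n - ρ ^ 2 := fun n => by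
    have := hTn_ge n
    have h2 : 0 < (T - ρ ^ 2) / 2 := by linarith
    linarith
  have hTn_mono : Monotone Tn := by
    intro m n hmn
    rw [hTn]; dsimp only
    have h1 : (T - ρ ^ 2) / ((n : ℝ) + 2) ≤ (T - ρ ^ 2) / ((m : ℝ) + 2) :=
      div_le_div_of_nonneg_left (by linarith) (by positivity) (by
        have : (m : ℝ) ≤ n := by exact_mod_cast hmn
        linarith)
    linarith
  have hTn_lim : Tendsto Tn atTop (𝓝 T) := by
    have h1 : Tendsto (fun n : ℕ => (T - ρ ^ 2) / ((n : ℝ) + 2)) atTop (𝓝 0) := by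
      have h2 : Tendsto (fun n : ℕ => ((n : ℝ) + 2)) atTop atTop :=
        tendsto_atTop_add_const_right _ _ tendsto_natCast_atTop_atTop
      exact (tendsto_const_nhds (x := T - ρ ^ 2)).div_atTop h2
    have h3 := (tendsto_const_nhds (x := T)).sub h1
    rw [sub_zero] at h3
    exact h3
  set S : ℕ → Set (ℝ × EuclideanSpace ℝ (Fin 3)) := fun n => Ioo (Tn n - ρ ^ 2) T ×ˢ ball x₀ ρ with hSdef
  have hSanti : Antitone S := by
    intro m n hmn
    refine prod_mono (Ioo_subset_Ioo ?_ le_rfl) Subset.rfl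
    linarith [hTn_mono hmn]
  have hSslab : ∀ n, S n ⊆ (Q : Set (ℝ × EuclideanSpace ℝ (Fin 3))) := fun n w hw =>
    ⟨⟨lt_trans (hTn_pos n) hw.1.1, hw.1.2⟩, mem_univ _⟩
  -- the slab integral of the density is finite
  have hI₃ : ∫⁻ w in Ioo 0 T ×ˢ (univ : Set (EuclideanSpace ℝ (Fin 3))), ‖u w.1 w.2‖ₑ ^ (3 : ℕ) < ⊤ :=
    SereginSverak2002.lintegral_slab_enorm_pow_three_lt_top one_pos hLH
  have hI₂ : ∫⁻ w in Ioo 0 T ×ˢ (univ : Set (EuclideanSpace ℝ (Fin 3))), ‖qg w.1 w.2‖ₑ ^ (3 / 2 : ℝ) < ⊤ := by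
    have h := SereginSverak2002.lintegral_slab_gauged_pressure_lt_top one_pos hT hsol hLH
    exact h
  have hum : AEMeasurable (fun q : ℝ × EuclideanSpace ℝ (Fin 3) => ‖u q.1 q.2‖ₑ ^ (3 : ℕ))
      (volume.restrict (Q : Set (ℝ × EuclideanSpace ℝ (Fin 3)))) :=
    (hsw.distributional.1.aestronglyMeasurable).aemeasurable.enorm.pow_const _
  have hνS0 : ν (S 0) ≠ ⊤ := by
    rw [hνdef, withDensity_apply _ (measurableSet_Ioo.prod measurableSet_ball)]
    refine (lt_of_le_of_lt (lintegral_mono_set (hSslab 0)) ?_).ne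
    show ∫⁻ q in (Q : Set (ℝ × EuclideanSpace ℝ (Fin 3))), g q < ⊤
    rw [hgdef, lintegral_add_left' hum]
    exact ENNReal.add_lt_top.2 ⟨hI₃, hI₂⟩
  -- ### continuity from above
  have hlim := tendsto_measure_iInter_atTop (μ := ν)
    (fun n => ((measurableSet_Ioo.prod measurableSet_ball : MeasurableSet (S n)).nullMeasurableSet))
    hSanti ⟨0, hνS0⟩
  -- the intersection is `Q_ρ(T, x₀)` up to a `ν`-null slice
  have hinter : ν (⋂ n, S n) ≤ ν (parabolicCylinder ρ (T, x₀)) := by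
    have hsub : (⋂ n, S n) ⊆ parabolicCylinder ρ (T, x₀) ∪ ({T - ρ ^ 2} ×ˢ (univ : Set (EuclideanSpace ℝ (Fin 3)))) := by
      intro w hw
      rw [mem_iInter] at hw
      have hx : w.2 ∈ ball x₀ ρ := (hw 0).2
      have htT : w.1 < T := (hw 0).1.2
      have hge : T - ρ ^ 2 ≤ w.1 := by
        refine le_of_tendsto (hTn_lim.sub_const (ρ ^ 2)) (Eventually.of_forall fun n => ?_)
        exact (hw n).1.1.le
      rcases hge.eq_or_lt with h | h
      · right; exact ⟨by rw [mem_singleton_iff]; exact h.symm, mem_univ _⟩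
      · left
        rw [mem_parabolicCylinder]
        exact ⟨⟨h, htT⟩, hx⟩
    have hnull : ν ({T - ρ ^ 2} ×ˢ (univ : Set (EuclideanSpace ℝ (Fin 3)))) = 0 := by
      refine hνac ?_
      rw [Measure.volume_eq_prod, Measure.prod_prod, Real.volume_singleton, zero_mul]
    calc ν (⋂ n, S n) ≤ ν (parabolicCylinder ρ (T, x₀) ∪ ({T - ρ ^ 2} ×ˢ (univ : Set (EuclideanSpace ℝ (Fin 3))))) :=
          measure_mono hsub
      _ ≤ ν (parabolicCylinder ρ (T, x₀)) + ν ({T - ρ ^ 2} ×ˢ (univ : Set (EuclideanSpace ℝ (Fin 3)))) :=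
          measure_union_le _ _
      _ = ν (parabolicCylinder ρ (T, x₀)) := by rw [hnull, add_zero]
  -- `ν(Q_ρ(T, x₀)) = ρ² (C + D)(ρ; (T, x₀)) < ρ² ε₁`
  have hcylQ : parabolicCylinder ρ (T, x₀) ⊆ (Q : Set (ℝ × EuclideanSpace ℝ (Fin 3))) := by
    intro w hw
    rw [mem_parabolicCylinder] at hw
    exact ⟨⟨by linarith [hw.1.1], hw.1.2⟩, mem_univ _⟩
  have hr2 : (ENNReal.ofReal ρ ^ 2) ≠ 0 := pow_ne_zero _ ((ENNReal.ofReal_pos.2 hρ).ne')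
  have hr2' : (ENNReal.ofReal ρ ^ 2) ≠ ⊤ := ENNReal.pow_ne_top ENNReal.ofReal_ne_top
  have hνcyl : ν (parabolicCylinder ρ (T, x₀)) < ENNReal.ofReal ρ ^ 2 * ENNReal.ofReal ε₁ := by
    rw [hνdef, withDensity_apply _ (isOpen_parabolicCylinder _ _).measurableSet, hgdef,
      lintegral_add_left' (hum.mono_measure (Measure.restrict_mono hcylQ le_rfl))]
    have e : (∫⁻ q in parabolicCylinder ρ (T, x₀), ‖u q.1 q.2‖ₑ ^ (3 : ℕ)) +
        ∫⁻ q in parabolicCylinder ρ (T, x₀), ‖qg q.1 q.2‖ₑ ^ (3 / 2 : ℝ) =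
        ENNReal.ofReal ρ ^ 2 * (cknC ρ (T, x₀) u + cknD ρ (T, x₀) qg) := by
      rw [cknC, cknD, mul_add, ← mul_assoc, ← mul_assoc, ENNReal.mul_inv_cancel hr2 hr2', one_mul, one_mul]
    rw [e, mul_comm, mul_comm (ENNReal.ofReal ρ ^ 2)]
    exact ENNReal.mul_lt_mul_left hr2 hr2' hsmall
  -- eventually `ν(S n) < ρ² ε₁`
  have hev : ∀ᶠ n in atTop, ν (S n) < ENNReal.ofReal ρ ^ 2 * ENNReal.ofReal ε₁ :=
    (tendsto_order.1 hlim).2 _ (hinter.trans_lt hνcyl)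
  obtain ⟨N, hN⟩ := hev.exists_forall_of_atTop
  -- ### the bound on each `Q_{ρ/2}(T_n, x₀)`, `n ≥ N`
  set L₀ : ℝ := cM * ε₁ ^ (1 / 3 : ℝ) / ρ with hL₀
  have hbd : ∀ n, N ≤ n → ∀ᵐ z ∂(volume.restrict (parabolicCylinder (ρ / 2) (Tn n, x₀))),
      ‖u z.1 z.2‖ ≤ L₀ := by
    intro n hn
    -- smallness at the apex `(T_n, x₀)`
    have hcylS : parabolicCylinder ρ (Tn n, x₀) ⊆ S n := by
      intro w hw
      rw [mem_parabolicCylinder] at hw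
      exact ⟨⟨hw.1.1, lt_of_lt_of_le hw.1.2 (hTn_lt n).le⟩, hw.2⟩
    have hsmall_n : cknC ρ (Tn n, x₀) u + cknD ρ (Tn n, x₀) qg ≤ ENNReal.ofReal ε₁ := by
      have h1 : (∫⁻ q in parabolicCylinder ρ (Tn n, x₀), ‖u q.1 q.2‖ₑ ^ (3 : ℕ)) +
          ∫⁻ q in parabolicCylinder ρ (Tn n, x₀), ‖qg q.1 q.2‖ₑ ^ (3 / 2 : ℝ) ≤ ν (S n) := by
        rw [hνdef, withDensity_apply _ (measurableSet_Ioo.prod measurableSet_ball), hgdef,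
          ← lintegral_add_left' (hum.mono_measure (Measure.restrict_mono
            (hcylS.trans (hSslab n)) le_rfl))]
        exact lintegral_mono_set hcylS
      have h2 : cknC ρ (Tn n, x₀) u + cknD ρ (Tn n, x₀) qg =
          (ENNReal.ofReal ρ ^ 2)⁻¹ * ((∫⁻ q in parabolicCylinder ρ (Tn n, x₀), ‖u q.1 q.2‖ₑ ^ (3 : ℕ)) +
            ∫⁻ q in parabolicCylinder ρ (Tn n, x₀), ‖qg q.1 q.2‖ₑ ^ (3 / 2 : ℝ)) := by
        rw [cknC, cknD, mul_add]
      rw [h2]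
      calc (ENNReal.ofReal ρ ^ 2)⁻¹ * ((∫⁻ q in parabolicCylinder ρ (Tn n, x₀), ‖u q.1 q.2‖ₑ ^ (3 : ℕ)) +
            ∫⁻ q in parabolicCylinder ρ (Tn n, x₀), ‖qg q.1 q.2‖ₑ ^ (3 / 2 : ℝ))
          ≤ (ENNReal.ofReal ρ ^ 2)⁻¹ * (ENNReal.ofReal ρ ^ 2 * ENNReal.ofReal ε₁) :=
            mul_le_mul' le_rfl (h1.trans (hN n hn).le)
        _ = ENNReal.ofReal ε₁ := by rw [← mul_assoc, ENNReal.inv_mul_cancel hr2 hr2', one_mul]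
    -- the closure of `Q_ρ(T_n, x₀)` lies in the slab
    have hcl : closure (parabolicCylinder ρ (Tn n, x₀)) ⊆ (Q : Set (ℝ × EuclideanSpace ℝ (Fin 3))) := by
      refine (closure_parabolicCylinder_subset ρ (Tn n, x₀)).trans ?_
      intro w hw
      exact ⟨⟨lt_of_lt_of_le (hTn_pos n) hw.1.1, lt_of_le_of_lt hw.1.2 (hTn_lt n)⟩, mem_univ _⟩
    exact ae_norm_le_of_small_of_suitableOn hsw H hρ hcl hε₁ le_rfl hsmall_n
  -- ### the cylinders `Q_{ρ/2}(T_{n+N}, x₀)` cover `Q_{ρ/2}(T, x₀)`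
  have hcover : parabolicCylinder (ρ / 2) (T, x₀) ⊆ ⋃ n : ℕ, parabolicCylinder (ρ / 2) (Tn (n + N), x₀) := by
    intro w hw
    rw [mem_parabolicCylinder] at hw
    obtain ⟨⟨h1, h2⟩, h3⟩ := hw
    have hev' : ∀ᶠ n in atTop, w.1 < Tn (n + N) :=
      ((hTn_lim.comp (tendsto_add_atTop_nat N)).eventually (lt_mem_nhds h2))
    obtain ⟨n, hn⟩ := hev'.exists
    rw [mem_iUnion]
    refine ⟨n, ?_⟩
    rw [mem_parabolicCylinder]
    refine ⟨⟨?_, hn⟩, h3⟩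
    have := hTn_lt (n + N)
    dsimp only at h1 ⊢
    linarith
  have hae : ∀ᵐ z ∂(volume.restrict (⋃ n : ℕ, parabolicCylinder (ρ / 2) (Tn (n + N), x₀))),
      ‖u z.1 z.2‖ ≤ L₀ := by
    rw [ae_restrict_iUnion_iff]
    exact fun n => hbd (n + N) (Nat.le_add_left _ _)
  have hae' : ∀ᵐ z ∂(volume.restrict (parabolicCylinder (ρ / 2) (T, x₀))), ‖uncurry u z‖ ≤ L₀ :=
    ae_restrict_of_ae_restrict_of_subset hcover hae
  rw [eLpNorm_exponent_top]
  exact eLpNormEssSup_lt_top_of_ae_bound hae'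

end ApexRegular





end Literature.Analysis.FluidPDE

end
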